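import Summits.Ventures.PackingBounds.Energy.FivePointRieszSixGramDataY1
import Summits.Ventures.PackingBounds.Energy.FivePointRieszSixGramDataY2
import Summits.Ventures.PackingBounds.Energy.FivePointRieszSixGramDataY3
import Summits.Ventures.PackingBounds.Energy.FivePointRieszSixGramDataY4
import Summits.Ventures.PackingBounds.Energy.FivePointRieszSixGramDataY5
import Summits.Ventures.PackingBounds.Energy.FivePointRieszSixGramDataY6
import HarnessLib

/-!
# Integer Gram data `S·Y = L Lᵀ + E` (S and the rows of S·Y: the table (collector of 6 part modules)) of the 158 × 158 SOS block of the exact sharp three-point certificate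
# `e3pt-sharp-n3N5s6d8-none.json` (triangular bipyramid; five points on S², single SOS term, d = 8)

Framing: lottery ticket; floor = certified bounds/negative ranges. Venture `PackingBounds`, cell `pub-packcert`, energy family E3PT
(pub-packcert-energy gen 15; KERNEL-D6 data route). `yR6` = S·Y (S = `scaleR6` = lcm of denominators · 2^40), `lR6` = rounded scaled Cholesky
factor, `eR6` = S·Y − lR6·lR6ᵀ (exact; symmetric, diagonally dominant). Checked by `decide +kernel` with `GramData.checkRows` / `checkDD`
in `FivePointRieszSixGramFacts*`; generator `pub-packcert-energy/code/e3pt/g15/e3pt_lean_n3x.py`. (Rows split in independent modules for the gate's request-size limit; one collector per table.)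
-/

namespace Summit.Ventures.PackingBounds.Energy.RieszSixD8

/-- The scale `S` (`yR6 = S·Y`). -/
def scaleR6 : ℤ := 841152091082642075821940405333655552

/-- data rows. -/
def yR6 : List (List ℤ) := [yR60, yR61, yR62, yR63, yR64, yR65, yR66, yR67, yR68, yR69, yR610, yR611, yR612, yR613, yR614, yR615, yR616, yR617, yR618, yR619, yR620, yR621, yR622, yR623, yR624, yR625, yR626, yR627, yR628, yR629, yR630, yR631, yR632, yR633, yR634, yR635, yR636, yR637, yR638, yR639, yR640, yR641, yR642, yR643, yR644, yR645, yR646, yR647, yR648, yR649, yR650, yR651, yR652, yR653, yR654, yR655, yR656, yR657, yR658, yR659, yR660, yR661, yR662, yR663, yR664, yR665, yR666, yR667, yR668, yR669, yR670, yR671, yR672, yR673, yR674, yR675, yR676, yR677, yR678, yR679, yR680, yR681, yR682, yR683, yR684, yR685, yR686, yR687, yR688, yR689, yR690, yR691, yR692, yR693, yR694, yR695, yR696, yR697, yR698, yR699, yR6100, yR6101, yR6102, yR6103, yR6104, yR6105, yR6106, yR6107, yR6108, yR6109, yR6110, yR6111, yR6112, yR6113, yR6114, yR6115, yR6116, yR6117,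 yR6118, yR6119, yR6120, yR6121, yR6122, yR6123, yR6124, yR6125, yR6126, yR6127, yR6128, yR6129, yR6130, yR6131, yR6132, yR6133, yR6134, yR6135, yR6136, yR6137, yR6138, yR6139, yR6140, yR6141, yR6142, yR6143, yR6144, yR6145, yR6146, yR6147, yR6148, yR6149, yR6150, yR6151, yR6152, yR6153, yR6154, yR6155, yR6156, yR6157]

end Summit.Ventures.PackingBounds.Energy.RieszSixD8
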